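import Summits.CriticalPhenomena.CardyFormulaZ2.Theses.CardyLeeYang
import Summits.CriticalPhenomena.CardyFormulaZ2.Theorems.RectilinearCardy.Negative.RectilinearCardyReductions

/-!
# Birth skeleton (BC3) for crux `RectilinearSuffices` (stmt-CriticalPhenomena-16791)

Route `CardyLeeYang` (route-CriticalPhenomena-CardyLeeYang), sub-problem `CardyFormulaZ2`, item
`RectilinearSuffices` (rank 9; a hypothesis of the route's `closes`):

  `RectilinearSuffices : (∀ R, IsRectilinear R → R.HasCrossingLimit (bond R) F) → CardyFormulaZ2`

— Cardy's formula for bond-`ℤ²` at `p = 1/2` in every RECTILINEAR conformal rectangle (Jordan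
boundary in finitely many axis-parallel segments) implies it in EVERY conformal rectangle. The item
is the verbatim twin of stmt-CriticalPhenomena-5663 (route `CardyBoundaryCoulombGas`), PROVED in the
tree (`Theorems.RectilinearSuffices_proof`, `Theorems/CardyBoundaryCoulombGasAssembly.lean`; the two
route decls are definitionally equal, so a prover closes this item by the one line
`:= fun h => Theorems.RectilinearApproximation.cardyFormulaZ2_of_rectilinearCardy h`). This file is
the registered two-stub skeleton the route audit asks for; it does NOT import that proof.

## The line: Bollobás–Riordan's two-sided rectilinear sandwich (Ch. 7, Claims 19–20, remark p. 195)

Fix a conformal rectangle `R` with uniformizing datum `(φ, x)`, `L = F(η_R) = cardyFunction (crossRatio x)`.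

* `stub_innerApprox` (`InnerRectilinearApprox`, the LOWER half; M–L): for every `e > 0` there is a
  RECTILINEAR conformal rectangle `P` with a uniformizing datum `(ψ, y)` whose Cardy value is
  `e`-close to `L` and whose G02 crossing event is, at every small mesh, contained in that of `R`:
  `bond P δ ≤ bond R δ` eventually as `δ → 0⁺`. Ingredients in the tree: the lower comparison
  quad (`OracleSandwich.stub_comparisonGeometry`, proved), the rectilinear approximant with the same
  marks and `ρ`-close loop (`Theorems.exists_rectilinear_close`), the deterministic inclusion
  `RectilinearApproximation.discreteCrossing_subset_of_lower`, and Radó continuity of the modulus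
  (`OracleSandwich.stub_cardyContinuity`, proved). Why it might fail: only bookkeeping (order of
  constants `e → ε₁ → (δ₀, t₀) → (Q, r) → P → δ`); mathematically settled.
* `stub_outerApprox` (`OuterRectilinearApprox`, the UPPER half; M–L): for every `e > 0` there is a
  rectilinear `P'` with datum `(ψ', y')` whose Cardy value is `e`-close to `1 - L` (the cyclically
  re-marked copy, `OracleSandwich.stub_cyclicFlip`) and `bond R δ ≤ 1 - bond P' δ` eventually
  (bond self-duality at `1/2`: a dual plate path of the upper comparison quad excludes a crossing of
  `R`, `RectilinearApproximation.bond_le_one_sub_real_openCrossing`, and a crossing of the outer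
  approximant `P'` is such a plate path, `discreteCrossing_subset_plate`). Why it might fail: as above.

ASSEMBLY `RectilinearSuffices_of` (real proof, pure filter/`linarith` logic, no `sorry`): given
`RectilinearCardy`, the approximants' crossing probabilities converge to their Cardy values, so
eventually `L - e < bond R δ < L + e`; `Metric.tendsto_nhds`.

BC3 probes (folder `bc/RectilinearSuffices_probe.lean`): each stub statement ALONE against the crux
and against `CardyFormulaZ2` by `first | exact? | simpa [X] | (unfold X; simpa) | aesop` — all four
FAIL (one half of a sandwich gives one inequality only). Disproof.lean: none exists for this crux
(`ledger crux ls`); negatives index (11 entries, 2026-08-17): no stub is an instance of a refuted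
statement (stmt-0748 concerns degenerate-arc junk values of `bondDomainCrossingProb`, excluded here by
nothing — the stubs are inequalities between genuine crossing probabilities and are consequences of
the landed sandwich theorems).

No new objects: `IsRectilinear` is the tree's (`Theorems.RectilinearCardy.Negative`, `rectilinearCardy_iff = Iff.rfl`);
two reducible `Registered.stub_*` aliases key the stub statements by name for the skeleton audit.
-/

noncomputable section

open Filter Topology Set
open UpperHalfPlane (upperHalfPlaneSet)
open Literature.Probability.RandomPlanarGeometry
open Literature.Probability.Percolation (bondDomainCrossingProb)
open Summit.CriticalPhenomena.CardyFormulaZ2.Theorems.RectilinearCardy.Negative (IsRectilinear)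

namespace Summit.CriticalPhenomena.CardyFormulaZ2.Cruxes.RectilinearSuffices.Birth

/-! ## The two stub statements -/

/-- **Inner rectilinear approximation (lower half of the sandwich).** For every conformal rectangle
`R` with uniformizing datum `(φ, x)` and every `e > 0` there is a rectilinear conformal rectangle
`P` with a uniformizing datum `(ψ, y)` such that `|F(crossRatio y) - F(crossRatio x)| ≤ e` and,
for all small meshes, every G02 crossing of `P_δ` is a G02 crossing of `R_δ`, whence
`bondDomainCrossingProb P δ ≤ bondDomainCrossingProb R δ` eventually as `δ → 0⁺`.
(Bollobás–Riordan 2006, Ch. 7 Claim 19, bond-`ℤ²` port; tree ingredients listed in the header.) -/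
def InnerRectilinearApprox : Prop :=
  ∀ (R : ConformalRectangle) (φ : ConformalEquiv upperHalfPlaneSet R.carrier) (x : Fin 4 → ℝ),
    R.IsUniformizing φ x → ∀ e : ℝ, 0 < e →
      ∃ (P : ConformalRectangle) (ψ : ConformalEquiv upperHalfPlaneSet P.carrier) (y : Fin 4 → ℝ),
        IsRectilinear P ∧ P.IsUniformizing ψ y ∧
        |cardyFunction (crossRatio y) - cardyFunction (crossRatio x)| ≤ e ∧
        ∀ᶠ δ : ℝ in 𝓝[>] 0, bondDomainCrossingProb P δ ≤ bondDomainCrossingProb R δ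

/-- **Outer rectilinear approximation of the flipped rectangle (upper half of the sandwich).** For
every conformal rectangle `R` with uniformizing datum `(φ, x)` and every `e > 0` there is a
rectilinear conformal rectangle `P'` with a uniformizing datum `(ψ', y')` such that
`|F(crossRatio y') - (1 - F(crossRatio x))| ≤ e` and `bondDomainCrossingProb R δ ≤ 1 -
bondDomainCrossingProb P' δ` eventually as `δ → 0⁺` (a crossing of `P'_δ` is an open plate path of
the upper comparison quad of the cyclically re-marked copy of `R`, whose dual excludes a crossing of
`R_δ`; bond self-duality at `p = 1/2`). (Bollobás–Riordan 2006, Ch. 7 Claim 20 + remark p. 195.) -/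
def OuterRectilinearApprox : Prop :=
  ∀ (R : ConformalRectangle) (φ : ConformalEquiv upperHalfPlaneSet R.carrier) (x : Fin 4 → ℝ),
    R.IsUniformizing φ x → ∀ e : ℝ, 0 < e →
      ∃ (P : ConformalRectangle) (ψ : ConformalEquiv upperHalfPlaneSet P.carrier) (y : Fin 4 → ℝ),
        IsRectilinear P ∧ P.IsUniformizing ψ y ∧
        |cardyFunction (crossRatio y) - (1 - cardyFunction (crossRatio x))| ≤ e ∧
        ∀ᶠ δ : ℝ in 𝓝[>] 0, bondDomainCrossingProb R δ ≤ 1 - bondDomainCrossingProb P δ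

/-! ## Stubs (`sorry` only here) -/

/-- **Stub 1 — the lower half** (`InnerRectilinearApprox`). Provable now from the tree's sandwich
API (see header); size M–L (ε/δ bookkeeping). -/
theorem stub_innerApprox : InnerRectilinearApprox := by
  sorry

/-- **Stub 2 — the upper half** (`OuterRectilinearApprox`). Provable now from the tree's sandwich
API and bond self-duality (see header); size M–L. -/
theorem stub_outerApprox : OuterRectilinearApprox := by
  sorry

/-! ## Name-keyed aliases of the stub statements (hypotheses of the composition) -/
namespace Registered

/-- Alias of the statement of `stub_innerApprox`, keyed by the stub name. -/
abbrev stub_innerApprox : Prop := InnerRectilinearApprox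

/-- Alias of the statement of `stub_outerApprox`, keyed by the stub name. -/
abbrev stub_outerApprox : Prop := OuterRectilinearApprox

end Registered

/-- Consistency: each alias IS its stub statement (definitionally) — the stubs inhabit the aliases. -/
theorem registered_of_stubs : Registered.stub_innerApprox ∧ Registered.stub_outerApprox :=
  ⟨stub_innerApprox, stub_outerApprox⟩

/-! ## The composition: the two stubs imply the crux BY NAME -/

/-- **`RectilinearSuffices` from the two halves of the sandwich.** Given Cardy's formula on
rectilinear conformal rectangles (`hRC`, the crux's hypothesis) and a conformal rectangle `R` with
datum `(φ, x)`, `L = F(crossRatio x)`: for `e > 0` the inner approximant `P` has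
`bond P δ → F(η_P) ≥ L - e/2`, so eventually `bond R δ ≥ bond P δ > L - e`; the outer approximant
`P'` has `bond P' δ → F(η_{P'}) ≥ 1 - L - e/2`, so eventually
`bond R δ ≤ 1 - bond P' δ < L + e`. Hence `bond R δ → L`. -/
theorem RectilinearSuffices_of (hin : Registered.stub_innerApprox)
    (hout : Registered.stub_outerApprox) :
    Summit.CriticalPhenomena.CardyFormulaZ2.Theses.CardyLeeYang.RectilinearSuffices := by
  intro hRC R φ x hux
  rw [Metric.tendsto_nhds]
  intro e he
  -- lower half: inner rectilinear approximant
  obtain ⟨P, ψ, y, hPS, hψ, hF, hle⟩ := hin R φ x hux (e / 2) (by positivity)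
  have hPlim : Tendsto (bondDomainCrossingProb P) (𝓝[>] 0)
      (𝓝 (cardyFunction (crossRatio y))) :=
    hRC P hPS ψ y hψ
  have hev1 : ∀ᶠ δ : ℝ in 𝓝[>] 0,
      cardyFunction (crossRatio y) - e / 2 < bondDomainCrossingProb P δ :=
    hPlim.eventually (lt_mem_nhds (by linarith))
  -- upper half: outer rectilinear approximant of the flipped rectangle
  obtain ⟨P', ψ', y', hPS', hψ', hF', hle'⟩ := hout R φ x hux (e / 2) (by positivity)
  have hPlim' : Tendsto (bondDomainCrossingProb P') (𝓝[>] 0)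
      (𝓝 (cardyFunction (crossRatio y'))) :=
    hRC P' hPS' ψ' y' hψ'
  have hev2 : ∀ᶠ δ : ℝ in 𝓝[>] 0,
      cardyFunction (crossRatio y') - e / 2 < bondDomainCrossingProb P' δ :=
    hPlim'.eventually (lt_mem_nhds (by linarith))
  filter_upwards [hev1, hle, hev2, hle'] with δ h1 h2 h3 h4
  have hFa := abs_sub_le_iff.1 hF
  have hFb := abs_sub_le_iff.1 hF'
  rw [Real.dist_eq, abs_sub_lt_iff]
  constructor <;> linarith [hFa.1, hFa.2, hFb.1, hFb.2]

end Summit.CriticalPhenomena.CardyFormulaZ2.Cruxes.RectilinearSuffices.Birth
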